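import Summits.QuantumFields.BalabanUV.Beta.GAN24.T2UnitSplitShapes
import Summits.QuantumFields.BalabanUV.Beta.MixedJetTablesPlug

/-!
# `BalabanUV.Beta.GAN24.T2UnitSplitBorder` — binder row G-an2-4 / (CONV-C), W-slot, road «W3» (F1): ROWS W3-F1a / W3-F1b AT A GENERIC
# BORDER TABLE AND AT an1's BORDER OF ANY ROOT (referee condition (w9) ROOT ALIGNMENT, row side for F1)
# (G-an2-4 FORMAL swarm, leaf-01 lineage, gen 15; «W3-F1-BORDER*»)

NOT IN PRINT; OUR BOOKKEEPING.  HONEST FRAMING (cell contract, verbatim): «discharging `BetaPertH` makes Bałaban's UV stability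
UNCONDITIONAL — a real constructive-QFT result; it is NOT the continuum limit and NOT the Clay problem.»  HONEST DEPENDENCY (verbatim):
«continuum YM on T⁴ ⇐ BetaPertH ∧ nine spine estimates (0/9 proved); BetaPertH ⇐ (D1) ∧ (D4) ∧ CAP+tail; G-an2-4 gates asym, D1 and
NE2/3/4.»

WHY.  The row owner's ENDs `WSlotT2OfPieces.t2Shape_of_rows` / `t2Drift_of_rows` (p213240) and the staged END #3 hard-code an1's BASE-root
border table `vh₂S d Lc` (= `vh₂SAt 0 Lc`), while an1's plug of record on the (D1) side is the CENTRED root and `WSlotMixedShape` §2–§3 are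
generic-root; referee 2's condition (w9) (REF2-DAG-AUDIT-r53, `beta/GAN24-TRIGGER-W.json` scope_update_53/55) asks for the border table to
become a PARAMETER of the ENDs with its shape binder `hB` (discharged by `MixedJetTablesPlug.hB_an1` at any box root).  The landed (F1a)
`T2UnitSplitShapes.unitS₂_T2Of_eq_transport_add_sum_of_shapes` already carries the generic-border text; the landed (F1b)
`T2UnitSplitShapes.unitS₂_T2Of_sub_eq_transport_add_sum_vh₂S_of_mix` does not.  This module supplies the missing texts, DERIVED from the
landed generic theorems (`T2UnitSplitLevels.unitS₂_T2Of_sub_eq_transport_add_sum`, `T2UnitSplitShapes.step_data_of_shapes`,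
`T2UnitSplitShapes.bdd₄_unitS₂_T2Of_of_shapes`) — nothing is re-proved, nothing landed is restated:
* §1 **(F1b) AT A GENERIC BORDER** `unitS₂_T2Of_sub_eq_transport_add_sum_of_shapes` — the `hsplit` of `t2Drift_of_rows` (END #3's `hsplitD`)
  with `vh₂S d Lc` replaced by a border PARAMETER `Bd` (off-diagonal: `hBff`, `hBmm`; shape `hB`), modulo `hB` and `hmix` only;
* §2 **(F1a)/(F1b) AT an1's BORDER OF ANY ROOT, generic mixed table** `unitS₂_T2Of_eq_transport_add_sum_vh₂SAt_of_mix` /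
  `unitS₂_T2Of_sub_eq_transport_add_sum_vh₂SAt_of_mix` (`vh₂S := vh₂SAt (toSite r) Lc`, `r ∈ box (d+1) Lc`; `hB := hB_an1` BY NAME, the
  off-diagonal facts by `rfl` — named twins: `T2OfDiffCovariance.vh₂SAt_inl_inl'` / `vh₂SAt_inr_inr'`), modulo `hmix` only;
* §3 **(F1a)/(F1b) WITH BOTH an1 TABLES AT ROOT `r` — NO TABLE HYPOTHESIS LEFT** `unitS₂_T2Of_eq_transport_add_sum_an1` /
  `unitS₂_T2Of_sub_eq_transport_add_sum_an1` (`mixFF := mixFFAt (toSite r) Lc`, `hmix := hmix_an1` BY NAME): residual binders `1 ≤ Lc`,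
  `r ∈ box (d+1) Lc` (centred root `ctrOff (d+1) Lc` by `AveragingContoursRooted.ctrOff_mem_box`).
The base-root theorems of `T2UnitSplitShapes` remain the texts of record for the ENDs AS TYPED.
[folklore] composition of tree theorems; every constant per level EXISTENTIAL; asserts NO j-uniform bound, NO zero mode, NO sum rule;
(F1) is bookkeeping and discharges NO estimate; instantiates NO wall binder; «T2Shape»/«T2SupRate» OPEN, NOT IN PRINT; discharges NOTHING of
(hW, hWall); NOT «W-slot closed», NEVER «G-an2-4 closed»; NOT BetaPertH, NOT continuum, NOT Clay.
-/

noncomputable section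

open Finset
open scoped BigOperators
open Literature.MathematicalPhysics.QuantumFieldTheory
open Literature.MathematicalPhysics.QuantumFieldTheory.Balaban1983to89
open Literature.MathematicalPhysics.QuantumFieldTheory.Balaban1983to89.Beta
open Literature.MathematicalPhysics.QuantumFieldTheory.Balaban1983to89.Beta.AffineAveraging (box toSite)
open ExpKernelCalculus (MKer Decays VertexFamily₂)
open OneStepResolventKernel (Fib)
open OneStepKernelFamily (KInvStep)
open StepJetData (mfNeg)
open SecondOrderResponse (W2SymOfK LocStencilFM)
open BalabanCompositeJets (LocStencil₂)
open BalabanStepJetsSucc (mmRead)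
open BalabanStepW2 (K3OfK Spure M1 M2Of T2Of)
open AveragingMixedJetTables (vh₂SAt mixFFAt)
open Summit.QuantumFields.BalabanUV.Beta.HessKerDressedUnits (unitK unitS)
open Summit.QuantumFields.BalabanUV.Beta.SecondOrderUnits (unitM unitS₂ unitM₂)
open Summit.QuantumFields.BalabanUV.Beta.MixedJetTablesPlug (hB_an1 hmix_an1)
open Summit.QuantumFields.BalabanUV.Beta.GAN24.CombesThomas (sfStep smStep)
open Summit.QuantumFields.BalabanUV.Beta.GAN24.T2RecursionAffine (lin4)
open Summit.QuantumFields.BalabanUV.Beta.GAN24.AffineUnroll (transport)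
open Summit.QuantumFields.BalabanUV.Beta.GAN24.T2UnitSplitLevels (unitS₂_T2Of_sub_eq_transport_add_sum)
open Summit.QuantumFields.BalabanUV.Beta.GAN24.T2UnitSplitShapes (step_data_of_shapes bdd₄_unitS₂_T2Of_of_shapes
  unitS₂_T2Of_eq_transport_add_sum_of_shapes)

namespace Summit.QuantumFields.BalabanUV.Beta.GAN24.T2UnitSplitBorder

variable {d : ℕ}

/-! ## §1 (F1b) AT A GENERIC BORDER TABLE: the level sum of the difference tower modulo `hB` and `hmix` only -/

section Border

variable {Lc : ℕ} [NeZero Lc] (cE cVH cΛ cE₂ cB : ℝ) (Tc : Fin 4 → Fin 4 → Fin 4 → Fin 4 → ℝ)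
  (mixFF : Fin (d + 1) → (Fin (d + 1) → ℤ) → Fin (d + 1) → (Fin (d + 1) → ℤ) → MKer (d + 1) (Fib d))

/-- [folklore] **(F1b) MODULO `hB` AND `hmix` ONLY** (generic off-diagonal border table `Bd`): the level sum of the one-step DIFFERENCES
`T2UnitSplitLevels.unitS₂_T2Of_sub_eq_transport_add_sum` with leaf-04's step data and the bounded entries discharged from the tree
(`T2UnitSplitShapes.step_data_of_shapes`, `bdd₄_unitS₂_T2Of_of_shapes`) — the `hsplit` of `WSlotT2OfPieces.t2Drift_of_rows` / the `hsplitD` of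
END #3 at `P′ m k := transport (fun j ↦ lin4 c₄ K♮_j Lc) (m+1) k`, forcing `f i := (𝒜_{i+1} − 𝒜_i)[T♮_i] + (b_{i+1} − b_i)`, border `Bd`.
The (F1b) twin of the landed (F1a) `T2UnitSplitShapes.unitS₂_T2Of_eq_transport_add_sum_of_shapes`. -/
theorem unitS₂_T2Of_sub_eq_transport_add_sum_of_shapes (hLc : 1 ≤ Lc)
    (Bd : Fin (d + 1) → (Fin (d + 1) → ℤ) → Fin (d + 1) → (Fin (d + 1) → ℤ) → MKer (d + 1) (Fib d))
    (hBff : ∀ κ u κ' u' x z (α β : Fin (d + 1)), Bd κ u κ' u' x z (Sum.inl α) (Sum.inl β) = 0)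
    (hBmm : ∀ κ u κ' u' x z (μ ν : Fin (d + 1)), Bd κ u κ' u' x z (Sum.inr μ) (Sum.inr ν) = 0)
    (hB : ∃ C δ : ℝ, 0 < δ ∧ LocStencil₂ Bd C δ) (hmix : ∃ C δ : ℝ, 0 < δ ∧ LocStencilFM Lc mixFF C δ) (n : ℕ) :
    (fun κ u κ' u' => unitS₂ (sfStep Lc (n + 1)) (smStep d Lc (n + 1)) (T2Of d Lc cE cVH cΛ cE₂ cB Tc Bd mixFF (n + 1)) κ u κ' u' -
        unitS₂ (sfStep Lc n) (smStep d Lc n) (T2Of d Lc cE cVH cΛ cE₂ cB Tc Bd mixFF n) κ u κ' u') =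
      transport (fun j => lin4 (cE₂ * (Lc : ℝ) ^ (2 * (d + 1))) (unitK (sfStep Lc j) (smStep d Lc j) (KInvStep (d := d) Lc j)) Lc) 1 n
            (fun κ u κ' u' =>
          unitS₂ (sfStep Lc 1) (smStep d Lc 1) (T2Of d Lc cE cVH cΛ cE₂ cB Tc Bd mixFF 1) κ u κ' u' -
            unitS₂ (sfStep Lc 0) (smStep d Lc 0) (T2Of d Lc cE cVH cΛ cE₂ cB Tc Bd mixFF 0) κ u κ' u') +
        ∑ i ∈ Finset.range n, transport (fun j => lin4 (cE₂ * (Lc : ℝ) ^ (2 * (d + 1)))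
              (unitK (sfStep Lc j) (smStep d Lc j) (KInvStep (d := d) Lc j)) Lc) (i + 2) (n - 1 - i)
          ((lin4 (cE₂ * (Lc : ℝ) ^ (2 * (d + 1))) (unitK (sfStep Lc (i + 1)) (smStep d Lc (i + 1)) (KInvStep (d := d) Lc (i + 1))) Lc
                (unitS₂ (sfStep Lc i) (smStep d Lc i) (T2Of d Lc cE cVH cΛ cE₂ cB Tc Bd mixFF i)) -
              lin4 (cE₂ * (Lc : ℝ) ^ (2 * (d + 1))) (unitK (sfStep Lc i) (smStep d Lc i) (KInvStep (d := d) Lc i)) Lc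
                    (unitS₂ (sfStep Lc i) (smStep d Lc i) (T2Of d Lc cE cVH cΛ cE₂ cB Tc Bd mixFF i))) +
            ((fun κ u κ' u' => (cE₂ * (Lc : ℝ) ^ (2 * (d + 1))) • mmRead Lc (K3OfK
                  (unitK (sfStep Lc (i + 1)) (smStep d Lc (i + 1)) (KInvStep (d := d) Lc (i + 1))) Lc
                  (unitS (sfStep Lc (i + 1)) (smStep d Lc (i + 1)) (Spure d Lc cE cVH cΛ (i + 1)))
                  (unitM (sfStep Lc (i + 1)) (smStep d Lc (i + 1)) (M1 d Lc cΛ (i + 1))) (W2SymOfK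
                  (unitK (sfStep Lc (i + 1)) (smStep d Lc (i + 1)) (KInvStep (d := d) Lc (i + 1))) Lc
                  (unitS (sfStep Lc (i + 1)) (smStep d Lc (i + 1)) (Spure d Lc cE cVH cΛ (i + 1)))
                  (unitM (sfStep Lc (i + 1)) (smStep d Lc (i + 1)) (M1 d Lc cΛ (i + 1))) 0
                  (unitM₂ (sfStep Lc (i + 1)) (smStep d Lc (i + 1)) (M2Of d Lc mixFF (i + 1)))) κ u κ' u') + cB • mfNeg (Bd κ u κ' u')) -
                  (fun κ u κ' u' => (cE₂ * (Lc : ℝ) ^ (2 * (d + 1))) • mmRead Lc (K3OfK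
                  (unitK (sfStep Lc i) (smStep d Lc i) (KInvStep (d := d) Lc i)) Lc (unitS (sfStep Lc i) (smStep d Lc i) (Spure d Lc cE cVH cΛ i))
                  (unitM (sfStep Lc i) (smStep d Lc i) (M1 d Lc cΛ i)) (W2SymOfK (unitK (sfStep Lc i) (smStep d Lc i) (KInvStep (d := d) Lc i)) Lc
                  (unitS (sfStep Lc i) (smStep d Lc i) (Spure d Lc cE cVH cΛ i)) (unitM (sfStep Lc i) (smStep d Lc i) (M1 d Lc cΛ i)) 0
                  (unitM₂ (sfStep Lc i) (smStep d Lc i) (M2Of d Lc mixFF i))) κ u κ' u') + cB • mfNeg (Bd κ u κ' u')))) :=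
  unitS₂_T2Of_sub_eq_transport_add_sum cE cVH cΛ cE₂ cB Tc Bd mixFF hBff hBmm
    (step_data_of_shapes hLc cE cVH cΛ cE₂ cB Tc hB hmix) (bdd₄_unitS₂_T2Of_of_shapes hLc cE cVH cΛ cE₂ cB Tc hB hmix) n

end Border

/-! ## §2 (F1a)/(F1b) AT an1's BORDER TABLE OF ANY ROOT, generic mixed table: modulo `hmix` only -/

section AnyRoot

variable {Lc : ℕ} [NeZero Lc] {r : Fin (d + 1) → ℕ} (cE cVH cΛ cE₂ cB : ℝ) (Tc : Fin 4 → Fin 4 → Fin 4 → Fin 4 → ℝ)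
  (mixFF : Fin (d + 1) → (Fin (d + 1) → ℤ) → Fin (d + 1) → (Fin (d + 1) → ℤ) → MKer (d + 1) (Fib d))

/-- [folklore] **(F1a) AT an1's BORDER `vh₂SAt (toSite r) Lc` OF ANY BOX ROOT `r`, MODULO `hmix` ONLY** — the `hsplit` of
`WSlotT2OfPieces.t2Shape_of_rows` re-rooted: `T2UnitSplitShapes.unitS₂_T2Of_eq_transport_add_sum_of_shapes` at `Bd := vh₂SAt (toSite r) Lc`,
border shape by `MixedJetTablesPlug.hB_an1` (BY NAME), off-diagonal entries `0` by `rfl`. -/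
theorem unitS₂_T2Of_eq_transport_add_sum_vh₂SAt_of_mix (hLc : 1 ≤ Lc) (hr : r ∈ box (d + 1) Lc)
    (hmix : ∃ C δ : ℝ, 0 < δ ∧ LocStencilFM Lc mixFF C δ) (n : ℕ) :
    unitS₂ (sfStep Lc n) (smStep d Lc n) (T2Of d Lc cE cVH cΛ cE₂ cB Tc (vh₂SAt (toSite r) Lc) mixFF n) =
      transport (fun j => lin4 (cE₂ * (Lc : ℝ) ^ (2 * (d + 1))) (unitK (sfStep Lc j) (smStep d Lc j) (KInvStep (d := d) Lc j)) Lc) 0 n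
            (unitS₂ (sfStep Lc 0) (smStep d Lc 0) (T2Of d Lc cE cVH cΛ cE₂ cB Tc (vh₂SAt (toSite r) Lc) mixFF 0)) +
        ∑ i ∈ Finset.range n, transport (fun j => lin4 (cE₂ * (Lc : ℝ) ^ (2 * (d + 1)))
              (unitK (sfStep Lc j) (smStep d Lc j) (KInvStep (d := d) Lc j)) Lc) (i + 1) (n - 1 - i)
              (fun κ u κ' u' => (cE₂ * (Lc : ℝ) ^ (2 * (d + 1))) • mmRead Lc (K3OfK (unitK (sfStep Lc i) (smStep d Lc i) (KInvStep (d := d) Lc i)) Lc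
              (unitS (sfStep Lc i) (smStep d Lc i) (Spure d Lc cE cVH cΛ i)) (unitM (sfStep Lc i) (smStep d Lc i) (M1 d Lc cΛ i)) (W2SymOfK
              (unitK (sfStep Lc i) (smStep d Lc i) (KInvStep (d := d) Lc i)) Lc (unitS (sfStep Lc i) (smStep d Lc i) (Spure d Lc cE cVH cΛ i))
              (unitM (sfStep Lc i) (smStep d Lc i) (M1 d Lc cΛ i)) 0
              (unitM₂ (sfStep Lc i) (smStep d Lc i) (M2Of d Lc mixFF i))) κ u κ' u') + cB • mfNeg ((vh₂SAt (toSite r) Lc) κ u κ' u')) :=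
  unitS₂_T2Of_eq_transport_add_sum_of_shapes cE cVH cΛ cE₂ cB Tc mixFF hLc (vh₂SAt (toSite r) Lc) (fun _ _ _ _ _ _ _ _ => rfl)
    (fun _ _ _ _ _ _ _ _ => rfl) (hB_an1 hLc hr) hmix n

/-- [folklore] **(F1b) AT an1's BORDER `vh₂SAt (toSite r) Lc` OF ANY BOX ROOT `r`, MODULO `hmix` ONLY** — the `hsplit` of
`WSlotT2OfPieces.t2Drift_of_rows` (END #3's `hsplitD`) re-rooted: §1 at `Bd := vh₂SAt (toSite r) Lc`, border shape by `hB_an1`. -/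
theorem unitS₂_T2Of_sub_eq_transport_add_sum_vh₂SAt_of_mix (hLc : 1 ≤ Lc) (hr : r ∈ box (d + 1) Lc)
    (hmix : ∃ C δ : ℝ, 0 < δ ∧ LocStencilFM Lc mixFF C δ) (n : ℕ) :
    (fun κ u κ' u' => unitS₂ (sfStep Lc (n + 1)) (smStep d Lc (n + 1)) (T2Of d Lc cE cVH cΛ cE₂ cB Tc (vh₂SAt (toSite r) Lc) mixFF (n + 1))
          κ u κ' u' -
        unitS₂ (sfStep Lc n) (smStep d Lc n) (T2Of d Lc cE cVH cΛ cE₂ cB Tc (vh₂SAt (toSite r) Lc) mixFF n) κ u κ' u') =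
      transport (fun j => lin4 (cE₂ * (Lc : ℝ) ^ (2 * (d + 1))) (unitK (sfStep Lc j) (smStep d Lc j) (KInvStep (d := d) Lc j)) Lc) 1 n
            (fun κ u κ' u' =>
          unitS₂ (sfStep Lc 1) (smStep d Lc 1) (T2Of d Lc cE cVH cΛ cE₂ cB Tc (vh₂SAt (toSite r) Lc) mixFF 1) κ u κ' u' -
            unitS₂ (sfStep Lc 0) (smStep d Lc 0) (T2Of d Lc cE cVH cΛ cE₂ cB Tc (vh₂SAt (toSite r) Lc) mixFF 0) κ u κ' u') +
        ∑ i ∈ Finset.range n, transport (fun j => lin4 (cE₂ * (Lc : ℝ) ^ (2 * (d + 1)))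
              (unitK (sfStep Lc j) (smStep d Lc j) (KInvStep (d := d) Lc j)) Lc) (i + 2) (n - 1 - i)
          ((lin4 (cE₂ * (Lc : ℝ) ^ (2 * (d + 1))) (unitK (sfStep Lc (i + 1)) (smStep d Lc (i + 1)) (KInvStep (d := d) Lc (i + 1))) Lc
                (unitS₂ (sfStep Lc i) (smStep d Lc i) (T2Of d Lc cE cVH cΛ cE₂ cB Tc (vh₂SAt (toSite r) Lc) mixFF i)) -
              lin4 (cE₂ * (Lc : ℝ) ^ (2 * (d + 1))) (unitK (sfStep Lc i) (smStep d Lc i) (KInvStep (d := d) Lc i)) Lc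
                    (unitS₂ (sfStep Lc i) (smStep d Lc i) (T2Of d Lc cE cVH cΛ cE₂ cB Tc (vh₂SAt (toSite r) Lc) mixFF i))) +
            ((fun κ u κ' u' => (cE₂ * (Lc : ℝ) ^ (2 * (d + 1))) • mmRead Lc (K3OfK
                  (unitK (sfStep Lc (i + 1)) (smStep d Lc (i + 1)) (KInvStep (d := d) Lc (i + 1))) Lc
                  (unitS (sfStep Lc (i + 1)) (smStep d Lc (i + 1)) (Spure d Lc cE cVH cΛ (i + 1)))
                  (unitM (sfStep Lc (i + 1)) (smStep d Lc (i + 1)) (M1 d Lc cΛ (i + 1))) (W2SymOfK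
                  (unitK (sfStep Lc (i + 1)) (smStep d Lc (i + 1)) (KInvStep (d := d) Lc (i + 1))) Lc
                  (unitS (sfStep Lc (i + 1)) (smStep d Lc (i + 1)) (Spure d Lc cE cVH cΛ (i + 1)))
                  (unitM (sfStep Lc (i + 1)) (smStep d Lc (i + 1)) (M1 d Lc cΛ (i + 1))) 0
                  (unitM₂ (sfStep Lc (i + 1)) (smStep d Lc (i + 1)) (M2Of d Lc mixFF (i + 1)))) κ u κ' u') +
                  cB • mfNeg ((vh₂SAt (toSite r) Lc) κ u κ' u')) -
                  (fun κ u κ' u' => (cE₂ * (Lc : ℝ) ^ (2 * (d + 1))) • mmRead Lc (K3OfK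
                  (unitK (sfStep Lc i) (smStep d Lc i) (KInvStep (d := d) Lc i)) Lc (unitS (sfStep Lc i) (smStep d Lc i) (Spure d Lc cE cVH cΛ i))
                  (unitM (sfStep Lc i) (smStep d Lc i) (M1 d Lc cΛ i)) (W2SymOfK (unitK (sfStep Lc i) (smStep d Lc i) (KInvStep (d := d) Lc i)) Lc
                  (unitS (sfStep Lc i) (smStep d Lc i) (Spure d Lc cE cVH cΛ i)) (unitM (sfStep Lc i) (smStep d Lc i) (M1 d Lc cΛ i)) 0
                  (unitM₂ (sfStep Lc i) (smStep d Lc i) (M2Of d Lc mixFF i))) κ u κ' u') + cB • mfNeg ((vh₂SAt (toSite r) Lc) κ u κ' u')))) :=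
  unitS₂_T2Of_sub_eq_transport_add_sum_of_shapes cE cVH cΛ cE₂ cB Tc mixFF hLc (vh₂SAt (toSite r) Lc) (fun _ _ _ _ _ _ _ _ => rfl)
    (fun _ _ _ _ _ _ _ _ => rfl) (hB_an1 hLc hr) hmix n

end AnyRoot

/-! ## §3 (F1a)/(F1b) WITH BOTH an1 TABLES AT ROOT `r`: no table hypothesis left -/

section An1

variable {Lc : ℕ} [NeZero Lc] {r : Fin (d + 1) → ℕ} (cE cVH cΛ cE₂ cB : ℝ) (Tc : Fin 4 → Fin 4 → Fin 4 → Fin 4 → ℝ)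

/-- [folklore] **(F1a) WITH an1's TABLES `vh₂SAt (toSite r) Lc`, `mixFFAt (toSite r) Lc` PLUGGED IN — NO TABLE HYPOTHESIS**: §2 at
`hmix := MixedJetTablesPlug.hmix_an1 hLc hr`.  Residual binders `1 ≤ Lc`, `r ∈ box (d+1) Lc` (the centred root `ctrOff (d+1) Lc` is a box
root by `AveragingContoursRooted.ctrOff_mem_box`). -/
theorem unitS₂_T2Of_eq_transport_add_sum_an1 (hLc : 1 ≤ Lc) (hr : r ∈ box (d + 1) Lc) (n : ℕ) :
    unitS₂ (sfStep Lc n) (smStep d Lc n) (T2Of d Lc cE cVH cΛ cE₂ cB Tc (vh₂SAt (toSite r) Lc) (mixFFAt (toSite r) Lc) n) =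
      transport (fun j => lin4 (cE₂ * (Lc : ℝ) ^ (2 * (d + 1))) (unitK (sfStep Lc j) (smStep d Lc j) (KInvStep (d := d) Lc j)) Lc) 0 n
            (unitS₂ (sfStep Lc 0) (smStep d Lc 0) (T2Of d Lc cE cVH cΛ cE₂ cB Tc (vh₂SAt (toSite r) Lc) (mixFFAt (toSite r) Lc) 0)) +
        ∑ i ∈ Finset.range n, transport (fun j => lin4 (cE₂ * (Lc : ℝ) ^ (2 * (d + 1)))
              (unitK (sfStep Lc j) (smStep d Lc j) (KInvStep (d := d) Lc j)) Lc) (i + 1) (n - 1 - i)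
              (fun κ u κ' u' => (cE₂ * (Lc : ℝ) ^ (2 * (d + 1))) • mmRead Lc (K3OfK (unitK (sfStep Lc i) (smStep d Lc i) (KInvStep (d := d) Lc i)) Lc
              (unitS (sfStep Lc i) (smStep d Lc i) (Spure d Lc cE cVH cΛ i)) (unitM (sfStep Lc i) (smStep d Lc i) (M1 d Lc cΛ i)) (W2SymOfK
              (unitK (sfStep Lc i) (smStep d Lc i) (KInvStep (d := d) Lc i)) Lc (unitS (sfStep Lc i) (smStep d Lc i) (Spure d Lc cE cVH cΛ i))
              (unitM (sfStep Lc i) (smStep d Lc i) (M1 d Lc cΛ i)) 0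
              (unitM₂ (sfStep Lc i) (smStep d Lc i) (M2Of d Lc (mixFFAt (toSite r) Lc) i))) κ u κ' u') +
                cB • mfNeg ((vh₂SAt (toSite r) Lc) κ u κ' u')) :=
  unitS₂_T2Of_eq_transport_add_sum_vh₂SAt_of_mix cE cVH cΛ cE₂ cB Tc (mixFFAt (toSite r) Lc) hLc hr (hmix_an1 hLc hr) n

/-- [folklore] **(F1b) WITH an1's TABLES `vh₂SAt (toSite r) Lc`, `mixFFAt (toSite r) Lc` PLUGGED IN — NO TABLE HYPOTHESIS**: §2 at
`hmix := MixedJetTablesPlug.hmix_an1 hLc hr`. -/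
theorem unitS₂_T2Of_sub_eq_transport_add_sum_an1 (hLc : 1 ≤ Lc) (hr : r ∈ box (d + 1) Lc) (n : ℕ) :
    (fun κ u κ' u' => unitS₂ (sfStep Lc (n + 1)) (smStep d Lc (n + 1))
          (T2Of d Lc cE cVH cΛ cE₂ cB Tc (vh₂SAt (toSite r) Lc) (mixFFAt (toSite r) Lc) (n + 1)) κ u κ' u' -
        unitS₂ (sfStep Lc n) (smStep d Lc n) (T2Of d Lc cE cVH cΛ cE₂ cB Tc (vh₂SAt (toSite r) Lc) (mixFFAt (toSite r) Lc) n) κ u κ' u') =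
      transport (fun j => lin4 (cE₂ * (Lc : ℝ) ^ (2 * (d + 1))) (unitK (sfStep Lc j) (smStep d Lc j) (KInvStep (d := d) Lc j)) Lc) 1 n
            (fun κ u κ' u' =>
          unitS₂ (sfStep Lc 1) (smStep d Lc 1) (T2Of d Lc cE cVH cΛ cE₂ cB Tc (vh₂SAt (toSite r) Lc) (mixFFAt (toSite r) Lc) 1) κ u κ' u' -
            unitS₂ (sfStep Lc 0) (smStep d Lc 0) (T2Of d Lc cE cVH cΛ cE₂ cB Tc (vh₂SAt (toSite r) Lc) (mixFFAt (toSite r) Lc) 0) κ u κ' u') +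
        ∑ i ∈ Finset.range n, transport (fun j => lin4 (cE₂ * (Lc : ℝ) ^ (2 * (d + 1)))
              (unitK (sfStep Lc j) (smStep d Lc j) (KInvStep (d := d) Lc j)) Lc) (i + 2) (n - 1 - i)
          ((lin4 (cE₂ * (Lc : ℝ) ^ (2 * (d + 1))) (unitK (sfStep Lc (i + 1)) (smStep d Lc (i + 1)) (KInvStep (d := d) Lc (i + 1))) Lc
                (unitS₂ (sfStep Lc i) (smStep d Lc i) (T2Of d Lc cE cVH cΛ cE₂ cB Tc (vh₂SAt (toSite r) Lc) (mixFFAt (toSite r) Lc) i)) -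
              lin4 (cE₂ * (Lc : ℝ) ^ (2 * (d + 1))) (unitK (sfStep Lc i) (smStep d Lc i) (KInvStep (d := d) Lc i)) Lc
                    (unitS₂ (sfStep Lc i) (smStep d Lc i) (T2Of d Lc cE cVH cΛ cE₂ cB Tc (vh₂SAt (toSite r) Lc) (mixFFAt (toSite r) Lc) i))) +
            ((fun κ u κ' u' => (cE₂ * (Lc : ℝ) ^ (2 * (d + 1))) • mmRead Lc (K3OfK
                  (unitK (sfStep Lc (i + 1)) (smStep d Lc (i + 1)) (KInvStep (d := d) Lc (i + 1))) Lc
                  (unitS (sfStep Lc (i + 1)) (smStep d Lc (i + 1)) (Spure d Lc cE cVH cΛ (i + 1)))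
                  (unitM (sfStep Lc (i + 1)) (smStep d Lc (i + 1)) (M1 d Lc cΛ (i + 1))) (W2SymOfK
                  (unitK (sfStep Lc (i + 1)) (smStep d Lc (i + 1)) (KInvStep (d := d) Lc (i + 1))) Lc
                  (unitS (sfStep Lc (i + 1)) (smStep d Lc (i + 1)) (Spure d Lc cE cVH cΛ (i + 1)))
                  (unitM (sfStep Lc (i + 1)) (smStep d Lc (i + 1)) (M1 d Lc cΛ (i + 1))) 0
                  (unitM₂ (sfStep Lc (i + 1)) (smStep d Lc (i + 1)) (M2Of d Lc (mixFFAt (toSite r) Lc) (i + 1)))) κ u κ' u') +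
                  cB • mfNeg ((vh₂SAt (toSite r) Lc) κ u κ' u')) -
                  (fun κ u κ' u' => (cE₂ * (Lc : ℝ) ^ (2 * (d + 1))) • mmRead Lc (K3OfK
                  (unitK (sfStep Lc i) (smStep d Lc i) (KInvStep (d := d) Lc i)) Lc (unitS (sfStep Lc i) (smStep d Lc i) (Spure d Lc cE cVH cΛ i))
                  (unitM (sfStep Lc i) (smStep d Lc i) (M1 d Lc cΛ i)) (W2SymOfK (unitK (sfStep Lc i) (smStep d Lc i) (KInvStep (d := d) Lc i)) Lc
                  (unitS (sfStep Lc i) (smStep d Lc i) (Spure d Lc cE cVH cΛ i)) (unitM (sfStep Lc i) (smStep d Lc i) (M1 d Lc cΛ i)) 0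
                  (unitM₂ (sfStep Lc i) (smStep d Lc i) (M2Of d Lc (mixFFAt (toSite r) Lc) i))) κ u κ' u') +
                  cB • mfNeg ((vh₂SAt (toSite r) Lc) κ u κ' u')))) :=
  unitS₂_T2Of_sub_eq_transport_add_sum_vh₂SAt_of_mix cE cVH cΛ cE₂ cB Tc (mixFFAt (toSite r) Lc) hLc hr (hmix_an1 hLc hr) n

end An1

end Summit.QuantumFields.BalabanUV.Beta.GAN24.T2UnitSplitBorder

end
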